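import Mathlib
import Summits.PneNP.PneNP.Theorems.ConvexRankGatesConvexGateBlindXorDefs

/-!
# PneNP / ConvexRankGates — `ConvexGateBlind`, line `xor-door-perfect-completeness`:
# the Index-lift rectangle lemma, core (support of `stub_exactLifting`, lead c4)

Registered sub-goal `indexRect_sum_mono_le` of crux item stmt-PneNP-10680 (line
`xor-door-perfect-completeness`, open stub `stub_exactLifting : XorDoor.ExactLifting`); the sibling
file `…ExactLiftingIndexRectangles.lean` finishes the rectangle lemma (sub-goal
`indexRect_card_mul_card_le`) from the facts collected here.

The matrices of `ExactLifting` are Index-lifts: rows are string tables `x : Fin m → Fin t → 𝔽₂`,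
columns are pointer tuples `w : Fin m → Fin t`, and the entry depends only on the looked-up word
`x[w] = (x i (w i))_i ∈ 𝔽₂^m` (`lookup`).  For `Z ⊆ 𝔽₂^m` and a set `W` of pointer tuples,
`tables Z W` is the largest row set `X` with `x[w] ∈ Z` on `X × W`; `NoSubcube Z κ` says that `Z`
contains no subcube of codimension `< κ`.  The rectangle lemma bounds `#W · #(tables Z W) · t^κ` by
`3^m t^m 2^{mt}` by induction on `m`, slicing off block `0`.  This file holds the slicing vocabulary
and the per-slice facts:

* `card_eq_sum_slices`, `card_tables_eq_sum` — `#W = ∑_{w̃} #S(w̃)` over reduced pointers `w̃` and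
  their slice sets `S(w̃) = {a : (a,w̃) ∈ W}`, and `#tables = ∑_c #tabT(c)` over the colourings
  `c = x 0` of block `0` (`lookup_cons`: `x[w] = (c (w 0), x̃[tail w])`);
* `tabT_subset_bi`, `tabT_subset_col` — under a colouring, a BICHROMATIC reduced pointer confines the
  reduced word to the double section `Z₀ ∩ Z₁`, one meeting colour `b` to the section `Z_b`;
* `noSubcube_inter`, `noSubcube_sec` — `Z₀ ∩ Z₁` keeps `κ`, `Z_b` keeps `κ - 1`;
* `card_const_on`, `card_mul_card_mono_le`, `sum_mono_le` (registered as `indexRect_sum_mono_le`) —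
  a slice set `S` is monochromatic for at most `2 · 2^{t-#S}` colourings and `#S · 2 · 2^{t-#S} ≤ 2^t`,
  so summed over colourings the monochromatic reduced pointers weigh at most `#live · 2^t`.

No definitions of record: everything here is a file-local abbreviation of this support pair
(namespace `…XorDoor.IndexRect`).
-/
set_option linter.dupNamespace false -- `Summit.PneNP.PneNP.…`: summit = sub-problem (D-0017)

namespace Summit.PneNP.PneNP.Theorems.XorDoor

open scoped BigOperators Classical
open Finset

noncomputable section

namespace IndexRect

variable {m t : ℕ}

/-! ## §1 Vocabulary of the lemma -/

/-- The looked-up word `x[w] ∈ 𝔽₂^m` of a string table `x` at a pointer tuple `w`. -/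
def lookup (x : Fin m → Fin t → ZMod 2) (w : Fin m → Fin t) : Fin m → ZMod 2 := fun i => x i (w i)

/-- The tables `x` whose looked-up words at all pointers of `W` lie in `Z` (the largest row set `X`
such that the rectangle `X × W` of the Index lift stays inside the lift of `Z`). -/
def tables (Z : Set (Fin m → ZMod 2)) (W : Finset (Fin m → Fin t)) : Finset (Fin m → Fin t → ZMod 2) :=
  univ.filter fun x => ∀ w ∈ W, lookup x w ∈ Z

/-- `Z` contains no subcube of codimension `< κ`: every partial assignment on `< κ` coordinates
extends to a point outside `Z`. -/
def NoSubcube (Z : Set (Fin m → ZMod 2)) (κ : ℕ) : Prop :=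
  ∀ S : Finset (Fin m), S.card < κ → ∀ z₀ : Fin m → ZMod 2, ∃ z : Fin m → ZMod 2, (∀ i ∈ S, z i = z₀ i) ∧ z ∉ Z

/-- The `b`-section of `Z ⊆ 𝔽₂^{m+1}` along coordinate `0`. -/
def sec (Z : Set (Fin (m + 1) → ZMod 2)) (b : ZMod 2) : Set (Fin m → ZMod 2) := {z | Fin.cons b z ∈ Z}

/-- The slice set of a reduced pointer `w̃`: the positions `a` of block `0` with `(a, w̃) ∈ W`. -/
def slices (W : Finset (Fin (m + 1) → Fin t)) (w' : Fin m → Fin t) : Finset (Fin t) :=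
  univ.filter fun a => (Fin.cons a w' : Fin (m + 1) → Fin t) ∈ W

/-- Reduced pointers whose slice set meets colour `b` under the colouring `c` of block `0`. -/
def colSet (W : Finset (Fin (m + 1) → Fin t)) (c : Fin t → ZMod 2) (b : ZMod 2) : Finset (Fin m → Fin t) :=
  univ.filter fun w' => ∃ a ∈ slices W w', c a = b

/-- Bichromatic reduced pointers under the colouring `c`. -/
def biSet (W : Finset (Fin (m + 1) → Fin t)) (c : Fin t → ZMod 2) : Finset (Fin m → Fin t) :=
  univ.filter fun w' => (∃ a ∈ slices W w', c a = 0) ∧ (∃ a ∈ slices W w', c a = 1)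

/-- Reduced pointers with a non-empty slice set (the image of `W` under `Fin.tail`). -/
def live (W : Finset (Fin (m + 1) → Fin t)) : Finset (Fin m → Fin t) :=
  univ.filter fun w' => (slices W w').Nonempty

/-- The reduced tables compatible with `W` once block `0` is coloured by `c`. -/
def tabT (Z : Set (Fin (m + 1) → ZMod 2)) (W : Finset (Fin (m + 1) → Fin t)) (c : Fin t → ZMod 2) :
    Finset (Fin m → Fin t → ZMod 2) :=
  univ.filter fun x' => ∀ w ∈ W, lookup x' (Fin.tail w) ∈ sec Z (c (w 0))

/-! ## §2 Elementary facts -/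

/-- In `ZMod 2`, a non-zero element is `1`. -/
theorem zmod2_eq_one_of_ne_zero {b : ZMod 2} (hb : b ≠ 0) : b = 1 := by
  fin_cases b
  · exact absurd rfl hb
  · rfl

/-- Case split in `ZMod 2` (from `zmod2_eq_one_of_ne_zero`). -/
theorem zmod2_cases (b : ZMod 2) : b = 0 ∨ b = 1 :=
  (eq_or_ne b 0).imp id zmod2_eq_one_of_ne_zero

/-- Looking up through a table with first block `c`: the word is `(c (w 0), x̃[tail w])`. -/
theorem lookup_cons (c : Fin t → ZMod 2) (x' : Fin m → Fin t → ZMod 2) (w : Fin (m + 1) → Fin t) :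
    lookup (Fin.cons c x' : Fin (m + 1) → Fin t → ZMod 2) w = Fin.cons (c (w 0)) (lookup x' (Fin.tail w)) := by
  funext i
  refine Fin.cases ?_ (fun j => ?_) i
  · simp [lookup]
  · simp [lookup, Fin.tail]

/-- `#W = ∑_{w̃} #S(w̃)`. -/
theorem card_eq_sum_slices (W : Finset (Fin (m + 1) → Fin t)) :
    W.card = ∑ w' : Fin m → Fin t, (slices W w').card := by
  have h1 : W.card = ∑ w : Fin (m + 1) → Fin t, (if w ∈ W then 1 else 0) := by
    rw [Finset.sum_boole]; simp
  rw [h1]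
  rw [← Fintype.sum_equiv (Fin.consEquiv fun _ : Fin (m + 1) => Fin t)
        (fun p => if (Fin.cons p.1 p.2 : Fin (m + 1) → Fin t) ∈ W then 1 else 0)
        (fun w => if w ∈ W then 1 else 0) (fun p => by simp [Fin.consEquiv])]
  rw [Fintype.sum_prod_type, Finset.sum_comm]
  refine Finset.sum_congr rfl fun w' _ => ?_
  rw [slices, Finset.card_filter]

/-- `#tables = ∑_c #tabT(c)`. -/
theorem card_tables_eq_sum (Z : Set (Fin (m + 1) → ZMod 2)) (W : Finset (Fin (m + 1) → Fin t)) :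
    (tables Z W).card = ∑ c : Fin t → ZMod 2, (tabT Z W c).card := by
  have h1 : (tables Z W).card =
      ∑ x : Fin (m + 1) → Fin t → ZMod 2, (if (∀ w ∈ W, lookup x w ∈ Z) then 1 else 0) := by
    rw [tables, Finset.card_filter]
  rw [h1]
  rw [← Fintype.sum_equiv (Fin.consEquiv fun _ : Fin (m + 1) => Fin t → ZMod 2)
        (fun p => if (∀ w ∈ W, lookup (Fin.cons p.1 p.2 : Fin (m + 1) → Fin t → ZMod 2) w ∈ Z) then 1 else 0)
        (fun x => if (∀ w ∈ W, lookup x w ∈ Z) then 1 else 0) (fun p => by simp [Fin.consEquiv])]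
  rw [Fintype.sum_prod_type]
  refine Finset.sum_congr rfl fun c _ => ?_
  rw [tabT, Finset.card_filter]
  refine Finset.sum_congr rfl fun x' _ => ?_
  refine if_congr ?_ rfl rfl
  simp only [lookup_cons, sec, Set.mem_setOf_eq]

/-- Bichromatic reduced pointers confine the reduced word to the double section `Z₀ ∩ Z₁`. -/
theorem tabT_subset_bi (Z : Set (Fin (m + 1) → ZMod 2)) (W : Finset (Fin (m + 1) → Fin t))
    (c : Fin t → ZMod 2) : tabT Z W c ⊆ tables (sec Z 0 ∩ sec Z 1) (biSet W c) := by
  intro x' hx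
  simp only [tabT, Finset.mem_filter, Finset.mem_univ, true_and] at hx
  simp only [tables, Finset.mem_filter, Finset.mem_univ, true_and]
  intro w' hw'
  simp only [biSet, Finset.mem_filter, Finset.mem_univ, true_and, slices] at hw'
  obtain ⟨⟨a, ha, ha0⟩, ⟨a', ha', ha1⟩⟩ := hw'
  refine ⟨?_, ?_⟩
  · have := hx _ ha
    simpa [Fin.tail_cons, Fin.cons_zero, ha0] using this
  · have := hx _ ha'
    simpa [Fin.tail_cons, Fin.cons_zero, ha1] using this

/-- Reduced pointers meeting colour `b` confine the reduced word to the section `Z_b`. -/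
theorem tabT_subset_col (Z : Set (Fin (m + 1) → ZMod 2)) (W : Finset (Fin (m + 1) → Fin t))
    (c : Fin t → ZMod 2) (b : ZMod 2) : tabT Z W c ⊆ tables (sec Z b) (colSet W c b) := by
  intro x' hx
  simp only [tabT, Finset.mem_filter, Finset.mem_univ, true_and] at hx
  simp only [tables, Finset.mem_filter, Finset.mem_univ, true_and]
  intro w' hw'
  simp only [colSet, Finset.mem_filter, Finset.mem_univ, true_and, slices] at hw'
  obtain ⟨a, ha, hab⟩ := hw'
  have := hx _ ha
  simpa [Fin.tail_cons, Fin.cons_zero, hab] using this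

/-- Every live reduced pointer meets colour `0` or colour `1`. -/
theorem live_subset_col (W : Finset (Fin (m + 1) → Fin t)) (c : Fin t → ZMod 2) :
    live W ⊆ colSet W c 0 ∪ colSet W c 1 := by
  intro w' hw'
  simp only [live, Finset.mem_filter, Finset.mem_univ, true_and] at hw'
  obtain ⟨a, ha⟩ := hw'
  simp only [Finset.mem_union, colSet, Finset.mem_filter, Finset.mem_univ, true_and]
  rcases zmod2_cases (c a) with h | h
  · exact Or.inl ⟨a, ha, h⟩
  · exact Or.inr ⟨a, ha, h⟩

/-- Bichromatic reduced pointers are live. -/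
theorem biSet_subset_live (W : Finset (Fin (m + 1) → Fin t)) (c : Fin t → ZMod 2) :
    biSet W c ⊆ live W := by
  intro w' hw'
  simp only [biSet, Finset.mem_filter, Finset.mem_univ, true_and] at hw'
  simp only [live, Finset.mem_filter, Finset.mem_univ, true_and]
  obtain ⟨⟨a, ha, _⟩, _⟩ := hw'
  exact ⟨a, ha⟩

/-! ### Sections inherit the subcube-freeness -/

/-- The double section `Z₀ ∩ Z₁` still has no subcube of codimension `< κ`. -/
theorem noSubcube_inter (Z : Set (Fin (m + 1) → ZMod 2)) {κ : ℕ} (h : NoSubcube Z κ) :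
    NoSubcube (sec Z 0 ∩ sec Z 1) κ := by
  intro S hS z₀
  obtain ⟨z, hzS, hzZ⟩ := h (S.map ⟨Fin.succ, Fin.succ_injective _⟩) (by simpa using hS) (Fin.cons 0 z₀)
  refine ⟨Fin.tail z, fun i hi => ?_, ?_⟩
  · have := hzS i.succ (by simpa using hi)
    simpa [Fin.tail] using this
  · intro hmem
    rcases zmod2_cases (z 0) with h0 | h0
    · apply hzZ
      have : Fin.cons (z 0) (Fin.tail z) ∈ Z := by rw [h0]; exact hmem.1
      simpa [Fin.cons_self_tail] using this
    · apply hzZ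
      have : Fin.cons (z 0) (Fin.tail z) ∈ Z := by rw [h0]; exact hmem.2
      simpa [Fin.cons_self_tail] using this

/-- A section `Z_b` has no subcube of codimension `< κ - 1`. -/
theorem noSubcube_sec (Z : Set (Fin (m + 1) → ZMod 2)) {k : ℕ} (h : NoSubcube Z (k + 1)) (b : ZMod 2) :
    NoSubcube (sec Z b) k := by
  intro S hS z₀
  obtain ⟨z, hzS, hzZ⟩ := h (insert 0 (S.map ⟨Fin.succ, Fin.succ_injective _⟩)) (by
      rw [Finset.card_insert_of_notMem (by simp [Fin.succ_ne_zero])]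
      simpa using hS) (Fin.cons b z₀)
  have hz0 : z 0 = b := by simpa using hzS 0 (Finset.mem_insert_self _ _)
  refine ⟨Fin.tail z, fun i hi => ?_, ?_⟩
  · have := hzS i.succ (Finset.mem_insert_of_mem (by simpa using hi))
    simpa [Fin.tail] using this
  · intro hmem
    apply hzZ
    have : Fin.cons (z 0) (Fin.tail z) ∈ Z := by rw [hz0]; exact hmem
    simpa [Fin.cons_self_tail] using this

/-! ### Counting colourings that are monochromatic on a slice set -/

/-- The number of colourings of `Fin t` constant equal to `b` on `S` is `2^{t - #S}`. -/
theorem card_const_on (S : Finset (Fin t)) (b : ZMod 2) :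
    (univ.filter fun c : Fin t → ZMod 2 => ∀ a ∈ S, c a = b).card = 2 ^ (t - S.card) := by
  have hset : (univ.filter fun c : Fin t → ZMod 2 => ∀ a ∈ S, c a = b) =
      Fintype.piFinset fun a => if a ∈ S then ({b} : Finset (ZMod 2)) else univ := by
    ext c
    simp only [Finset.mem_filter, Finset.mem_univ, true_and, Fintype.mem_piFinset]
    constructor
    · intro h a
      by_cases ha : a ∈ S
      · simp [ha, h a ha]
      · simp [ha]
    · intro h a ha
      have := h a
      simpa [ha] using this
  rw [hset, Fintype.card_piFinset]
  have : ∀ a : Fin t, ((if a ∈ S then ({b} : Finset (ZMod 2)) else univ).card) = if a ∈ S then 1 else 2 := by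
    intro a; split_ifs <;> simp
  simp_rw [this]
  rw [Finset.prod_ite, Finset.prod_const_one, one_mul, Finset.prod_const]
  congr 1
  have h1 : (univ.filter fun a : Fin t => a ∈ S) = S := by ext a; simp
  have h2 : (univ.filter fun a : Fin t => ¬ a ∈ S) = univ \ S := by ext a; simp
  rw [h2, Finset.card_sdiff_of_subset (Finset.subset_univ _), Finset.card_univ, Fintype.card_fin]

/-- Weighted count of the colourings that are NOT bichromatic on `S`: `#S · #{c mono on S} ≤ 2^t`. -/
theorem card_mul_card_mono_le (S : Finset (Fin t)) :
    S.card * (univ.filter fun c : Fin t → ZMod 2 =>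
      ¬ ((∃ a ∈ S, c a = 0) ∧ (∃ a ∈ S, c a = 1))).card ≤ 2 ^ t := by
  rcases S.eq_empty_or_nonempty with rfl | hS
  · simp
  have hsub : (univ.filter fun c : Fin t → ZMod 2 => ¬ ((∃ a ∈ S, c a = 0) ∧ (∃ a ∈ S, c a = 1))) ⊆
      (univ.filter fun c : Fin t → ZMod 2 => ∀ a ∈ S, c a = 1) ∪
      (univ.filter fun c : Fin t → ZMod 2 => ∀ a ∈ S, c a = 0) := by
    intro c hc
    simp only [Finset.mem_filter, Finset.mem_univ, true_and] at hc
    simp only [Finset.mem_union, Finset.mem_filter, Finset.mem_univ, true_and]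
    by_cases h0 : ∃ a ∈ S, c a = 0
    · have h1 : ¬ ∃ a ∈ S, c a = 1 := fun h1 => hc ⟨h0, h1⟩
      right
      intro a ha
      rcases zmod2_cases (c a) with h | h
      · exact h
      · exact absurd ⟨a, ha, h⟩ h1
    · left
      intro a ha
      rcases zmod2_cases (c a) with h | h
      · exact absurd ⟨a, ha, h⟩ h0
      · exact h
  have hcard := (Finset.card_le_card hsub).trans (Finset.card_union_le _ _)
  rw [card_const_on, card_const_on] at hcard
  have hSt : S.card ≤ t := by simpa using Finset.card_le_univ S
  have hd : 1 ≤ S.card := Finset.card_pos.2 hS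
  calc S.card * _ ≤ S.card * (2 ^ (t - S.card) + 2 ^ (t - S.card)) := Nat.mul_le_mul_left _ hcard
    _ = (2 * S.card) * 2 ^ (t - S.card) := by ring
    _ ≤ 2 ^ S.card * 2 ^ (t - S.card) := by
        refine Nat.mul_le_mul_right _ ?_
        -- `2d ≤ 2^d` for `d ≥ 1`, from `d - 1 < 2^(d-1)`
        obtain ⟨d, hd'⟩ : ∃ d, S.card = d + 1 := ⟨S.card - 1, by omega⟩
        have hlt : d < 2 ^ d := Nat.lt_two_pow_self
        rw [hd', pow_succ]
        omega
    _ = 2 ^ t := by rw [← pow_add, Nat.add_sub_cancel' hSt]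

/-- Summed over colourings, the monochromatic reduced pointers weigh at most `#live · 2^t`. -/
theorem sum_mono_le (W : Finset (Fin (m + 1) → Fin t)) :
    ∑ c : Fin t → ZMod 2, ∑ w' ∈ univ.filter (fun w' => w' ∉ biSet W c), (slices W w').card
      ≤ (live W).card * 2 ^ t := by
  have h1 : ∀ c : Fin t → ZMod 2,
      ∑ w' ∈ univ.filter (fun w' => w' ∉ biSet W c), (slices W w').card
        = ∑ w' : Fin m → Fin t, (if w' ∉ biSet W c then (slices W w').card else 0) := by
    intro c; rw [Finset.sum_filter]
  have h2 : ∀ w' : Fin m → Fin t,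
      ∑ c : Fin t → ZMod 2, (if w' ∉ biSet W c then (slices W w').card else 0)
        = (slices W w').card * (univ.filter fun c : Fin t → ZMod 2 =>
            ¬ ((∃ a ∈ slices W w', c a = 0) ∧ (∃ a ∈ slices W w', c a = 1))).card := by
    intro w'
    rw [Finset.card_filter, Finset.mul_sum]
    refine Finset.sum_congr rfl fun c _ => ?_
    have : (w' ∉ biSet W c) ↔ ¬ ((∃ a ∈ slices W w', c a = 0) ∧ (∃ a ∈ slices W w', c a = 1)) := by
      simp [biSet]
    by_cases h : w' ∉ biSet W c
    · rw [if_pos h, if_pos (this.1 h), mul_one]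
    · rw [if_neg h, if_neg (fun h' => h (this.2 h')), mul_zero]
  have h3 : ∀ w' : Fin m → Fin t,
      (slices W w').card * (univ.filter fun c : Fin t → ZMod 2 =>
          ¬ ((∃ a ∈ slices W w', c a = 0) ∧ (∃ a ∈ slices W w', c a = 1))).card
        ≤ if (slices W w').Nonempty then 2 ^ t else 0 := by
    intro w'
    split_ifs with hne
    · exact card_mul_card_mono_le (slices W w')
    · rw [Finset.not_nonempty_iff_eq_empty] at hne
      simp [hne]
  calc ∑ c : Fin t → ZMod 2, ∑ w' ∈ univ.filter (fun w' => w' ∉ biSet W c), (slices W w').card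
      = ∑ c : Fin t → ZMod 2, ∑ w' : Fin m → Fin t,
          (if w' ∉ biSet W c then (slices W w').card else 0) := Finset.sum_congr rfl fun c _ => h1 c
    _ = ∑ w' : Fin m → Fin t, ∑ c : Fin t → ZMod 2,
          (if w' ∉ biSet W c then (slices W w').card else 0) := Finset.sum_comm
    _ ≤ ∑ w' : Fin m → Fin t, (if (slices W w').Nonempty then 2 ^ t else 0) :=
        Finset.sum_le_sum fun w' _ => (h2 w').le.trans (h3 w')
    _ = (live W).card * 2 ^ t := by
        rw [live, Finset.card_filter, Finset.sum_mul]
        refine Finset.sum_congr rfl fun w' _ => ?_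
        split_ifs <;> simp

/-! ## §3 The registered sub-goal of this core file -/

end IndexRect

/-- **Registered sub-goal `indexRect_sum_mono_le` of stmt-PneNP-10680**: summed over the colourings
`c` of block `0`, the slice sets of the reduced pointers that are NOT bichromatic under `c` weigh at
most `#live · 2^t` (the monochromatic charge of the rectangle lemma's induction step). -/
theorem indexRect_sum_mono_le :
    ∀ (m t : ℕ) (W : Finset (Fin (m + 1) → Fin t)),
      ∑ c : Fin t → ZMod 2, ∑ w' ∈ Finset.univ.filter (fun w' => w' ∉ IndexRect.biSet W c),
          (IndexRect.slices W w').card ≤ (IndexRect.live W).card * 2 ^ t :=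
  fun _ _ W => IndexRect.sum_mono_le W

end

end Summit.PneNP.PneNP.Theorems.XorDoor
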